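import Mathlib
import Summits.MatrixMultiplication.MatrixMultiplication.Theorems.SnSubsetDichotomyPolynomialSlackPolylogPower

/-!
# The fibring gain eventually beats the polynomial loss

Crux `Summit.MatrixMultiplication.MatrixMultiplication.Theses.SnSubsetDichotomy.PolynomialSlack`
(item `stmt-MatrixMultiplication-8306`), level-one programme, line transport-split-hull (lead c6,
"beyond one half"), registered stub `eventually_gain`.

In the induction on `n` for TPP volumes in `S_n`, a violating triple at `n` fibres over `S_{n-1}`
with loss factor `8·(G₁ + G₂)`, where

  `G₁ = 100·Λ³·(64 n² M³)² / (n-1)³`,  `G₂ = n·(1024 n M³)² / (n-1)²`,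
  `Λ = 200·(1 + log n)·log(256 n³)`,  `M = n ^ m`,  `m = ε + 1/24`,

against the neutral rate `n^{3/2}`; the induction closes once `8·(G₁ + G₂) ≤ n^{3/2 - κ}` with
`κ = (1/4 - 6ε)/4`, and this file proves that this holds for all large `n` (`eventually_gain`).

Proof.  Put `G = 1 + log n ≥ 1` and `L = log(256 n³) = log 256 + 3 log n ≤ 255 + 3 log n ≤ 255·G`
(`log 256 ≤ 255` is `Real.log_le_sub_one_of_pos`).  For `n ≥ 2` we have `n ≤ 2(n-1)`, so
`n³ ≤ 8(n-1)³` and `n² ≤ 4(n-1)²`; with `M⁶ = n^{6m}` this gives the purely algebraic estimate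
(`eventually_gain_core`)

  `8·(G₁ + G₂) ≤ C · G⁶ · (n · M⁶) = C · (1 + log n)⁶ · n^{1 + 6m}`

for an absolute constant `C`, and the master lemma `eventually_log_pow_mul_rpow_le` with `k = 6`,
`p = 1 + 6m = 5/4 + 6ε`, `q = 3/2 - κ = 23/16 + 3ε/2` applies because `q - p = 3/16 - 9ε/2 > 0`
exactly when `ε < 1/24`.
-/

namespace Summit.MatrixMultiplication.MatrixMultiplication.Theorems.PolynomialSlack

-- `Summit.<Summit>.<Problem>` is the tree's mandated summit-side namespace; for this
-- single-conjunct summit the two coincide, so the file silences `dupNamespace`.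
set_option linter.dupNamespace false

/-- **Algebraic core of the gain estimate.** For reals `x ≥ 2`, `G ≥ 1`, `0 ≤ L ≤ 255·G` and
`M > 0`,
`8·(100·(200 G L)³·(64 x² M³)²/(x-1)³ + x·(1024 x M³)²/(x-1)²) ≤ C·G⁶·(x·M⁶)` with the absolute
constant `C = 8·(100·(200·255)³·4096·8 + 4·1024²)`: clear the denominators with
`x³ ≤ 8(x-1)³`, `x² ≤ 4(x-1)²` (from `x ≤ 2(x-1)`) and bound `(200 G L)³ ≤ (200·255·G²)³`,
`1 ≤ G⁶`. [folklore] -/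
theorem eventually_gain_core (x G L M : ℝ) (hx : 2 ≤ x) (hG : 1 ≤ G) (hL0 : 0 ≤ L)
    (hL : L ≤ 255 * G) (hM : 0 < M) :
    8 * (100 * (200 * G * L) ^ 3 * (64 * x ^ 2 * M ^ 3) ^ 2 / (x - 1) ^ 3 +
        x * (1024 * x * M ^ 3) ^ 2 / (x - 1) ^ 2) ≤
      8 * (100 * (200 * 255) ^ 3 * 4096 * 8 + 4 * 1024 ^ 2) * G ^ 6 * (x * M ^ 6) := by
  have hx0 : 0 < x := by linarith
  have hx1 : 0 < x - 1 := by linarith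
  have hG0 : 0 ≤ G := by linarith
  have h1 : (200 * G * L) ^ 3 ≤ (200 * G * (255 * G)) ^ 3 :=
    pow_le_pow_left₀ (by positivity) (mul_le_mul_of_nonneg_left hL (by positivity)) 3
  have h2 : x ^ 3 ≤ (2 * (x - 1)) ^ 3 := pow_le_pow_left₀ hx0.le (by linarith) 3
  have h2' : x ^ 2 ≤ (2 * (x - 1)) ^ 2 := pow_le_pow_left₀ hx0.le (by linarith) 2
  have hG6 : 1 ≤ G ^ 6 := one_le_pow₀ hG
  have hT1 : 100 * (200 * G * L) ^ 3 * (64 * x ^ 2 * M ^ 3) ^ 2 / (x - 1) ^ 3 ≤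
      100 * (200 * 255) ^ 3 * 4096 * 8 * G ^ 6 * (x * M ^ 6) := by
    rw [div_le_iff₀ (by positivity)]
    calc 100 * (200 * G * L) ^ 3 * (64 * x ^ 2 * M ^ 3) ^ 2
        = 100 * 4096 * x * M ^ 6 * ((200 * G * L) ^ 3 * x ^ 3) := by ring
      _ ≤ 100 * 4096 * x * M ^ 6 * ((200 * G * (255 * G)) ^ 3 * (2 * (x - 1)) ^ 3) :=
          mul_le_mul_of_nonneg_left (mul_le_mul h1 h2 (by positivity) (by positivity))
            (by positivity)
      _ = 100 * (200 * 255) ^ 3 * 4096 * 8 * G ^ 6 * (x * M ^ 6) * (x - 1) ^ 3 := by ring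
  have hT2 : x * (1024 * x * M ^ 3) ^ 2 / (x - 1) ^ 2 ≤ 4 * 1024 ^ 2 * G ^ 6 * (x * M ^ 6) := by
    rw [div_le_iff₀ (by positivity)]
    calc x * (1024 * x * M ^ 3) ^ 2 = 1024 ^ 2 * (x * M ^ 6) * (1 * x ^ 2) := by ring
      _ ≤ 1024 ^ 2 * (x * M ^ 6) * (G ^ 6 * (2 * (x - 1)) ^ 2) :=
          mul_le_mul_of_nonneg_left (mul_le_mul hG6 h2' (by positivity) (by positivity))
            (by positivity)
      _ = 4 * 1024 ^ 2 * G ^ 6 * (x * M ^ 6) * (x - 1) ^ 2 := by ring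
  calc 8 * (100 * (200 * G * L) ^ 3 * (64 * x ^ 2 * M ^ 3) ^ 2 / (x - 1) ^ 3 +
          x * (1024 * x * M ^ 3) ^ 2 / (x - 1) ^ 2)
      ≤ 8 * (100 * (200 * 255) ^ 3 * 4096 * 8 * G ^ 6 * (x * M ^ 6) +
          4 * 1024 ^ 2 * G ^ 6 * (x * M ^ 6)) :=
        mul_le_mul_of_nonneg_left (add_le_add hT1 hT2) (by norm_num)
    _ = 8 * (100 * (200 * 255) ^ 3 * 4096 * 8 + 4 * 1024 ^ 2) * G ^ 6 * (x * M ^ 6) := by ring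

/-- **The fibring gain eventually beats the polynomial loss** (registered stub `eventually_gain`
of line `transport-split-hull`): for `0 < ε < 1/24`, `m = ε + 1/24`, `κ = (1/4 - 6ε)/4` there is
`n₁` such that for all naturals `n ≥ n₁`, with `Λ = 200(1 + log n) log(256 n³)` and `M = n ^ m`,
`8·(100 Λ³ (64 n² M³)²/(n-1)³ + n (1024 n M³)²/(n-1)²) ≤ n^{3/2 - κ}`.
Proof: `eventually_gain_core` bounds the left side by `C (1 + log n)⁶ n^{1 + 6m}` for `n ≥ 2`
(`log(256 n³) ≤ 255 (1 + log n)`, `n · (n^m)⁶ = n^{1+6m}` by `Real.rpow_add`/`Real.rpow_mul`),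
and `eventually_log_pow_mul_rpow_le` with `k = 6`, `p = 1 + 6m < q = 3/2 - κ` (i.e. `ε < 1/24`)
finishes. [folklore] -/
theorem eventually_gain (ε : ℝ) (hε0 : 0 < ε) (hε1 : ε < 1 / 24) (m κ : ℝ)
    (hm : m = ε + 1 / 24) (hκ : κ = (1 / 4 - 6 * ε) / 4) :
    ∃ n₁ : ℕ, ∀ n : ℕ, n₁ ≤ n →
      8 * (100 * (200 * (1 + Real.log n) * Real.log (256 * (n : ℝ) ^ 3)) ^ 3 *
            (64 * (n : ℝ) ^ 2 * ((n : ℝ) ^ m) ^ 3) ^ 2 / ((n : ℝ) - 1) ^ 3 +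
          (n : ℝ) * (1024 * (n : ℝ) * ((n : ℝ) ^ m) ^ 3) ^ 2 / ((n : ℝ) - 1) ^ 2) ≤
        (n : ℝ) ^ ((3 : ℝ) / 2 - κ) := by
  have hpq : 1 + 6 * m < 3 / 2 - κ := by rw [hm, hκ]; linarith
  obtain ⟨n₀, hn₀⟩ := eventually_log_pow_mul_rpow_le 6 (1 + 6 * m) (3 / 2 - κ)
    (8 * (100 * (200 * 255) ^ 3 * 4096 * 8 + 4 * 1024 ^ 2)) hpq (by norm_num)
  refine ⟨max n₀ 2, fun n hn => ?_⟩
  have hn2 : (2 : ℝ) ≤ n := by exact_mod_cast le_of_max_le_right hn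
  have hx0 : (0 : ℝ) < n := by linarith
  have hlog0 : 0 ≤ Real.log n := Real.log_nonneg (by linarith)
  have hL0 : 0 ≤ Real.log (256 * (n : ℝ) ^ 3) := by
    refine Real.log_nonneg ?_
    have : (1 : ℝ) ≤ (n : ℝ) ^ 3 := one_le_pow₀ (by linarith)
    linarith
  have hL : Real.log (256 * (n : ℝ) ^ 3) ≤ 255 * (1 + Real.log n) := by
    rw [Real.log_mul (by norm_num) (pow_pos hx0 3).ne', Real.log_pow]
    have h256 := Real.log_le_sub_one_of_pos (show (0 : ℝ) < 256 by norm_num)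
    push_cast
    linarith
  have hP : (n : ℝ) ^ (1 + 6 * m) = (n : ℝ) * ((n : ℝ) ^ m) ^ 6 := by
    rw [Real.rpow_add hx0, Real.rpow_one, mul_comm (6 : ℝ) m, Real.rpow_mul hx0.le]
    congr 1
    exact_mod_cast Real.rpow_natCast ((n : ℝ) ^ m) 6
  have key := hn₀ n (le_of_max_le_left hn)
  rw [hP] at key
  exact (eventually_gain_core (n : ℝ) (1 + Real.log n) (Real.log (256 * (n : ℝ) ^ 3))
    ((n : ℝ) ^ m) hn2 (by linarith) hL0 hL (Real.rpow_pos_of_pos hx0 m)).trans key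

end Summit.MatrixMultiplication.MatrixMultiplication.Theorems.PolynomialSlack
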